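import Summits.HubbardSuperconductivity.HubbardSuperconductivity.Theorems.AnisotropyChordStiffnessFerroPointStiffness
import Summits.HubbardSuperconductivity.HubbardSuperconductivity.Theorems.AnisotropyChordInsertionEntropyGroundStateDeconfinement

/-!
# Route `AnisotropyChord` / H0 rotor rung: THE FERROMAGNETIC POINT IN THE TELEPORTATION CURRENCY — `T ≡ 0`,
# `GroundStateTeleDeconfined 1 M` and `EventualCondensate 1 M` (H0 consistency anchor, theory seat
# `hubbard-h0-rotor-theory-1` cycle 10 memo §145 × cycle 9 memo §136)

At `Δ = 1` the Perron sector ground amplitude is uniform on its sector (F1, `perronAmplitude_at_one_uniform`), so every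
one-particle teleportation preserves the amplitude: the mean teleportation log-ratio vanishes identically
(`meanTeleLog_at_one_eq_zero`), the Hamiltonian-level H0-T hypothesis holds with constant `0`
(`groundStateTeleDeconfined_at_one`), and the model-independent floor of `…GroundStateFloor` gives the uniform condensate
density `ρ_L(1−ρ_L) ≤ condensateDensity a` (`condensateDensity_at_one_ge`) and **`eventualCondensate_at_one`** along any
density window.  Together with `variationalTwistStiffness_at_one` (rung FM) the ferromagnetic point is the anchor at which
(S_tw), H0-T and BEC are simultaneously tree theorems.
-/

set_option linter.dupNamespace false

noncomputable section

open Matrix Complex Finset Filter Topology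
open Literature.MathematicalPhysics.QuantumLattice hiding torusPhase torusNorm
open Literature.Probability.LatticeModels
open Summit.HubbardSuperconductivity.HubbardSuperconductivity.Theorems.AnisotropyChord.Stiffness.Doob
  (perronAmplitude_at_one_uniform)

namespace Summit.HubbardSuperconductivity.HubbardSuperconductivity.Theorems.AnisotropyChord.InsertionEntropy

section FerroPoint

variable {L : ℕ} [NeZero L]

/-- For an amplitude uniform on a sector, every teleportation summand of `meanTeleLog` vanishes. [folklore] -/
theorem teleTerm_eq_zero_of_uniform {a : TensorIndex (TorusSite 2 L) 2 → ℝ} {W : ℕ} {u : ℝ}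
    (hunif : ∀ σ, a σ = if Stiffness.Exch.occ σ = W then u else 0) (σ : TensorIndex (TorusSite 2 L) 2)
    (x y : TorusSite 2 L) :
    a σ ^ 2 * (if σ x = 0 ∧ σ y = 1 then Real.log (a (σ ∘ Equiv.swap x y) ^ 2 / a σ ^ 2) else 0) = 0 := by
  have hswap : a (σ ∘ Equiv.swap x y) = a σ := by
    rw [hunif, hunif σ,
      show (σ ∘ ⇑(Equiv.swap x y)) = σ ∘ (Equiv.swap x y : Equiv.Perm (TorusSite 2 L)) from rfl,
      Stiffness.Exch.occ_comp_perm]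
  rw [hswap]
  by_cases h0 : a σ = 0
  · rw [h0]; simp
  · have : a σ ^ 2 / a σ ^ 2 = 1 := div_self (pow_ne_zero 2 h0)
    rw [this, Real.log_one]; simp

/-- **`T ≡ 0` at the ferromagnetic point:** the mean teleportation log-ratio of the Perron sector ground amplitude
of `H(1)` vanishes (every teleport preserves the uniform amplitude). [folklore] -/
theorem meanTeleLog_at_one_eq_zero (M : ℝ) (a : TensorIndex (TorusSite 2 L) 2 → ℝ)
    (ha : IsPerronSectorGroundAmplitude L 1 M a) (N : ℝ) : meanTeleLog a N = 0 := by
  obtain ⟨W, u, -, -, hunif⟩ := perronAmplitude_at_one_uniform M a ha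
  unfold meanTeleLog
  have hnum : (∑ σ, a σ ^ 2 * ∑ x, ∑ y,
      if σ x = 0 ∧ σ y = 1 then Real.log (a (σ ∘ Equiv.swap x y) ^ 2 / a σ ^ 2) else 0) = 0 := by
    refine Finset.sum_eq_zero fun σ _ => ?_
    rw [Finset.mul_sum]
    refine Finset.sum_eq_zero fun x _ => ?_
    rw [Finset.mul_sum]
    exact Finset.sum_eq_zero fun y _ => teleTerm_eq_zero_of_uniform hunif σ x y
  rw [hnum, zero_div]

/-- **H0-T holds at `Δ = 1` with constant `0`:** `GroundStateTeleDeconfined 1 M`. [folklore] -/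
theorem groundStateTeleDeconfined_at_one (M : ℕ → ℝ) : GroundStateTeleDeconfined 1 M :=
  ⟨0, Filter.Eventually.of_forall fun L _ aN ha => by
    rw [meanTeleLog_at_one_eq_zero (M L) aN ha, neg_zero]⟩

/-- **Condensate density of the ferromagnetic Perron amplitude:** `ρ_L(1 − ρ_L) ≤ condensateDensity a`,
`ρ_L = 1/2 + M/L²` (the model-independent floor `condensateDensity_ge_exp_meanTeleLog_of_isPerron` at `T = 0`).
[folklore] -/
theorem condensateDensity_at_one_ge (M : ℝ) (a : TensorIndex (TorusSite 2 L) 2 → ℝ)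
    (ha : IsPerronSectorGroundAmplitude L 1 M a) :
    (1 / 2 + M / (L : ℝ) ^ 2) * (1 - (1 / 2 + M / (L : ℝ) ^ 2)) ≤ condensateDensity a := by
  have h := condensateDensity_ge_exp_meanTeleLog_of_isPerron L 1 M a ha
  rw [meanTeleLog_at_one_eq_zero M a ha, zero_div, Real.exp_zero, mul_one] at h
  exact h

/-- **BEC at the ferromagnetic point in the `EventualCondensate` currency:** along `ρ_L = 1/2 + M_L/L² → ρ ∈ (0,1)`,
`EventualCondensate 1 M` (via `eventualCondensate_of_groundStateTeleDeconfined` at `K = 0`). [folklore] -/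
theorem eventualCondensate_at_one (M : ℕ → ℝ) (ρ : ℝ) (hρ : ρ ∈ Set.Ioo (0 : ℝ) 1)
    (hlim : Tendsto (fun L : ℕ => 1 / 2 + M L / (L : ℝ) ^ 2) atTop (𝓝 ρ)) : EventualCondensate 1 M :=
  eventualCondensate_of_groundStateTeleDeconfined 1 M ρ hρ hlim (groundStateTeleDeconfined_at_one M)

end FerroPoint

end Summit.HubbardSuperconductivity.HubbardSuperconductivity.Theorems.AnisotropyChord.InsertionEntropy
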